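import Literature.Topology.FourManifolds.TubeFamilyConstruction
import Literature.Topology.FourManifolds.ConeDifferentialLink
import HarnessLib

/-!
# The circle-link stage (codimension two) of the sweep

Topic `Literature/Topology/FourManifolds`; the `k = 1` companion of
`TubeFamilyConstruction.ShellReadable.exists_sphereStage` in the downward sweep of the smoothing
of PD homeomorphisms (Munkres, Ann. of Math. 72 (1960), §5; Campbell–D'Onofrio–Vítek (2026),
Lemma 3.2).  For codimension-two simplices the link is a circle, and a local diffeomorphism of the
circle is a diffeomorphism only with a degree input; the sweep supplies it as CLOSENESS of the
rescaled fibre map at the link level to a positively homogeneous homeomorphism `L` of `ℝ²`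
bounded below by `μ ‖·‖` (the conewise differential, `ConeDifferentialComposite.lean`):
`‖(r/4)⁻¹ N (x₀, (r/4) θ) - L θ‖ ≤ δ` with `2δ < μ` (`ConeDifferentialLink.lean`,
`CircleLinkBijective.lean`).  With that:

* `ShellReadable.exists_linkDiffeomorph_circle` — the link map at `x₀` is a diffeomorphism of `𝕊¹`;
* `ShellReadable.exists_familyAdmissible_circle`, `ShellReadable.exists_circleStage` — the
  admissible untwist family and the stage (smooth with invertible derivative on `V' × B(0, r)` for
  every core depth `t₀`), from the dichotomy for the diffeomorphisms of `𝕊¹` (a theorem of the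
  tree, `Diffeomorph.isDiffeotopicToId_or_isDiffeotopic_sphereReflection_circle`; it is taken as
  a hypothesis of the same shape as `H_{k+1}` in the sphere case so that the sweep treats all
  codimensions uniformly).

Everything is proved; no definitions; no named facts.

## References

* J. R. Munkres, *Obstructions to the smoothing of piecewise-differentiable homeomorphisms*, Ann.
  of Math. (2) 72 (1960), 521–554, §5. [Munkres1960]
* D. Campbell, L. D'Onofrio, T. Vítek, *Diffeomorphic approximation of piecewise affine
  homeomorphisms*, J. Geom. Anal. 36 (2026), Lemma 3.2. [CampbellDonofrioVitek2026]
-/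

noncomputable section

open Set Function Metric Filter Module
open scoped Topology ContDiff Manifold RealInnerProductSpace

namespace Literature.Topology.FourManifolds

local notation "𝔽[" n "]" => EuclideanSpace ℝ (Fin (n + 1))
local notation "𝕊[" n "]" => (Metric.sphere (0 : EuclideanSpace ℝ (Fin (n + 1))) 1)

variable {E : Type*} [NormedAddCommGroup E] [NormedSpace ℝ E]
variable {θ₀ : 𝕊[1]} {N : E × 𝔽[1] → 𝔽[1]} {r : ℝ} {χ : E → ℝ} {x₀ : E} {V V' B : Set E}
  {T : E × 𝔽[1] → E} {ρ K₀ C₁ : ℝ}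

/-- **The circle link diffeomorphism of a readable shell** at a base point `x₀ ∈ V`, from the
closeness of the rescaled fibre map at the link level to a positively homogeneous homeomorphism
`L` bounded below by `μ ‖·‖`, `2δ < μ`. [cite: CampbellDonofrioVitek2026, Lemma 3.2] -/
theorem ShellReadable.exists_linkDiffeomorph_circle (hS : ShellReadable V r ρ K₀ C₁ T N)
    (hr : 0 < r) (hx₀ : x₀ ∈ V) (L : 𝔽[1] ≃ₜ 𝔽[1])
    (hL : ∀ (v : 𝔽[1]) (c : ℝ), 0 ≤ c → L (c • v) = c • L v) {μ δ : ℝ} (hμ : 0 < μ)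
    (hμL : ∀ v : 𝔽[1], μ * ‖v‖ ≤ ‖L v‖)
    (hδ : ∀ θ : 𝕊[1], ‖(r / 4)⁻¹ • N (x₀, (r / 4) • (θ : 𝔽[1])) - L θ‖ ≤ δ) (hδμ : 2 * δ < μ) :
    ∃ φ : 𝕊[1] ≃ₘ⟮𝓡 1, 𝓡 1⟯ 𝕊[1], ∀ θ, φ θ = linkSphereMap θ₀ N (r / 4) x₀ θ :=
  Literature.Topology.FourManifolds.exists_linkDiffeomorph_circle (by positivity)
    (fun θ => (hS.linkData hr hx₀ θ).1)
    (fun θ => (hS.linkData hr hx₀ θ).2.2.1) (fun θ => (hS.linkData hr hx₀ θ).2.2.2) L hL hμ hμL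
    hδ hδμ

/-- **The admissible family for circle links.** As `ShellReadable.exists_familyAdmissible`,
with the link diffeomorphism from `exists_linkDiffeomorph_circle` and the dichotomy for the
diffeomorphisms of `𝕊¹`. [cite: CampbellDonofrioVitek2026, Lemma 3.2] -/
theorem ShellReadable.exists_familyAdmissible_circle (hS : ShellReadable V r ρ K₀ C₁ T N)
    (H : ∀ (v : 𝕊[1]) (φ : 𝕊[1] ≃ₘ⟮𝓡 1, 𝓡 1⟯ 𝕊[1]),
      Diffeomorph.IsDiffeotopicToId φ ∨ Diffeomorph.IsDiffeotopic (sphereReflection v) φ)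
    (hr : 0 < r) (hVc : Convex ℝ V) (hx₀ : x₀ ∈ V) (hBV : B ⊆ V) (hV'V : V' ⊆ V)
    (hχ : ContDiff ℝ ∞ χ) (hχ01 : ∀ x, χ x ∈ Icc (0 : ℝ) 1) (hχB : ∀ x ∉ B, χ x = 0)
    (hχV' : ∀ x ∈ V', χ x = 1) (L : 𝔽[1] ≃ₜ 𝔽[1])
    (hL : ∀ (v : 𝔽[1]) (c : ℝ), 0 ≤ c → L (c • v) = c • L v) {μ δ : ℝ} (hμ : 0 < μ)
    (hμL : ∀ v : 𝔽[1], μ * ‖v‖ ≤ ‖L v‖)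
    (hδ : ∀ θ : 𝕊[1], ‖(r / 4)⁻¹ • N (x₀, (r / 4) • (θ : 𝔽[1])) - L θ‖ ≤ δ) (hδμ : 2 * δ < μ) :
    ∃ (D : Diffeotopy (𝓡 1) 𝕊[1]) (Rs : 𝕊[1] ≃ₘ⟮𝓡 1, 𝓡 1⟯ 𝕊[1]) (R : 𝔽[1] →ₗᵢ[ℝ] 𝔽[1]),
      Surjective R ∧ (∀ θ : 𝕊[1], ((Rs θ : 𝕊[1]) : 𝔽[1]) = R θ) ∧
        (∀ θ : 𝕊[1], D.toFun 1 (Rs θ) = linkSphereMap θ₀ N (r / 4) x₀ θ) ∧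
        ∀ t₀ : ℝ, 0 < t₀ → t₀ < 3 * r / 32 →
          FamilyAdmissible V' r R t₀ N (tubeFamily θ₀ D Rs N r χ x₀) (logPacing t₀ (3 * r / 32)) := by
  obtain ⟨φ, hφ⟩ := hS.exists_linkDiffeomorph_circle (θ₀ := θ₀) hr hx₀ L hL hμ hμL hδ hδμ
  obtain ⟨D, Rs, R, hRsurj, hRs, hD⟩ := exists_diffeotopy_of_dichotomy (H θ₀ φ)
  refine ⟨D, Rs, R, hRsurj, hRs, fun θ => (hD θ).trans (hφ θ), fun t₀ ht₀ ht₀r => ?_⟩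
  exact familyAdmissible_tubeFamily hr hS hVc hx₀ hBV hV'V hχ hχ01 hχB hχV' hRs Rs.contMDiff
    (injective_mfderiv_sphereDiffeomorph Rs) (fun θ => (hD θ).trans (hφ θ)) ht₀ ht₀r

/-- **The circle-link stage (codimension two) in one chart pair.** As
`ShellReadable.exists_sphereStage` with the circle link input: untwist data `D`, `Rs`, `R` such
that for every core depth `0 < t₀ < 3r/32` the tube family is admissible over `V'` and the tube
stage map is `C^∞` with invertible derivative on the open tube `V' × B(0, r)`.
[cite: CampbellDonofrioVitek2026, Lemma 3.2] -/
theorem ShellReadable.exists_circleStage [FiniteDimensional ℝ E]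
    (hS : ShellReadable V r ρ K₀ C₁ T N)
    (H : ∀ (v : 𝕊[1]) (φ : 𝕊[1] ≃ₘ⟮𝓡 1, 𝓡 1⟯ 𝕊[1]),
      Diffeomorph.IsDiffeotopicToId φ ∨ Diffeomorph.IsDiffeotopic (sphereReflection v) φ)
    (hr : 0 < r) (hVc : Convex ℝ V) (hV'o : IsOpen V') (hx₀ : x₀ ∈ V) (hBV : B ⊆ V)
    (hV'V : V' ⊆ V) (hχ : ContDiff ℝ ∞ χ) (hχ01 : ∀ x, χ x ∈ Icc (0 : ℝ) 1)
    (hχB : ∀ x ∉ B, χ x = 0) (hχV' : ∀ x ∈ V', χ x = 1) (hK₀1 : 1 ≤ K₀)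
    (hK₀ : ∀ t : ℝ, 0 < t → t ≤ r / 2 → |1 - t * deriv (stagePacing r) t / stagePacing r t| ≤ K₀)
    (hρ : 0 < ρ) (hC₁ : ∀ t : ℝ, |deriv (flattenCutoff r) t| ≤ C₁ / r) (L : 𝔽[1] ≃ₜ 𝔽[1])
    (hL : ∀ (v : 𝔽[1]) (c : ℝ), 0 ≤ c → L (c • v) = c • L v) {μ δ : ℝ} (hμ : 0 < μ)
    (hμL : ∀ v : 𝔽[1], μ * ‖v‖ ≤ ‖L v‖)
    (hδ : ∀ θ : 𝕊[1], ‖(r / 4)⁻¹ • N (x₀, (r / 4) • (θ : 𝔽[1])) - L θ‖ ≤ δ) (hδμ : 2 * δ < μ) :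
    ∃ (D : Diffeotopy (𝓡 1) 𝕊[1]) (Rs : 𝕊[1] ≃ₘ⟮𝓡 1, 𝓡 1⟯ 𝕊[1]) (R : 𝔽[1] →ₗᵢ[ℝ] 𝔽[1]),
      Surjective R ∧ (∀ θ : 𝕊[1], ((Rs θ : 𝕊[1]) : 𝔽[1]) = R θ) ∧
        (∀ θ : 𝕊[1], D.toFun 1 (Rs θ) = linkSphereMap θ₀ N (r / 4) x₀ θ) ∧
        ∀ t₀ : ℝ, 0 < t₀ → t₀ < 3 * r / 32 →
          FamilyAdmissible V' r R t₀ N (tubeFamily θ₀ D Rs N r χ x₀) (logPacing t₀ (3 * r / 32)) ∧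
          ∀ p : E × 𝔽[1], p.1 ∈ V' → ‖p.2‖ < r →
            ContDiffAt ℝ ∞
                (tubeStageMap r ρ T N (tubeFamily θ₀ D Rs N r χ x₀) (logPacing t₀ (3 * r / 32))) p ∧
              ∃ L' : (E × 𝔽[1]) ≃L[ℝ] E × 𝔽[1],
                HasFDerivAt
                  (tubeStageMap r ρ T N (tubeFamily θ₀ D Rs N r χ x₀) (logPacing t₀ (3 * r / 32)))
                  (L' : E × 𝔽[1] →L[ℝ] E × 𝔽[1]) p := by
  obtain ⟨D, Rs, R, hRsurj, hRs, hD, hadm⟩ :=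
    hS.exists_familyAdmissible_circle (θ₀ := θ₀) H hr hVc hx₀ hBV hV'V hχ hχ01 hχB hχV' L hL hμ
      hμL hδ hδμ
  refine ⟨D, Rs, R, hRsurj, hRs, hD, fun t₀ ht₀ ht₀r => ⟨hadm t₀ ht₀ ht₀r, fun p hp1 hpr => ?_⟩⟩
  have hS' : ShellReadable V' r ρ K₀ C₁ T N := hS.subset hV'V
  exact ⟨hS'.contDiffAt_tubeStageMap (hadm t₀ ht₀ ht₀r) hr hV'o hp1 hpr,
    hS'.exists_hasFDerivAt_equiv_tubeStageMap (hadm t₀ ht₀ ht₀r) hr hV'o hRsurj hK₀1 hK₀ hρ hC₁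
      hp1 hpr⟩

end Literature.Topology.FourManifolds
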